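import Summits.CriticalPhenomena.SAWScalingLimit.Theorems.SAWDevelopingMapObservableToSLECanonicalTransferAssembly
import Literature.Probability.RandomPlanarGeometry.JordanDomainInterior
import Literature.Probability.Percolation.SitePaths
import HarnessLib

/-!
# Crux `SAWDevelopingMap.ObservableToSLE` (stmt-CriticalPhenomena-10472), line
`floor-ratio-restriction-bootstrap`, stub `stub_canonicalTransfer`: canonical walks leave the
inner family only next to the boundary ((M2'a) from boundary avoidance)

Landing target:
`Summits/CriticalPhenomena/SAWScalingLimit/Theorems/SAWDevelopingMapObservableToSLECanonicalTransferBoundaryExit.lean`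
(`--supports stmt-CriticalPhenomena-10472`).  Sequel of `…CanonicalTransferAssembly.lean`.

The canonical insensitivity (M2'a) `P^{can}_δ(γ ⊆ Λ δ ∪ {a δ, b δ}) → 1` of the discretisation
input of `canonicalTransfer_ofDiscretisation`, for the inner family `Λ δ` = component of the bulk
vertex in the `25δ`-deep vertices (exact floor rows near the marked points), is reduced here to
BOUNDARY AVOIDANCE of the canonical critical SAW away from the marked points: a canonical SAW
leaving `Λ δ ∪ {a δ, b δ}` does so, at its first exit, within `25δ` of
`∂D ∖ (B(pt 0, 11ρ') ∪ B(pt 1, 11ρ'))` (deep neighbours of the family are in the family; pendant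
floor vertices cannot be traversed by a self-avoiding walk).

* `exists_dart_exit` (= registered sub-goal `stub_canonicalTransfer_boundaryExit`),
  `exists_dart_fst_eq` — walk combinatorics;
* `exists_near_frontier_of_exit` — the fixed-mesh exit lemma;
* `canonicalInsensitivity_of_boundaryAvoidance` — (M2'a) from boundary avoidance.
-/

noncomputable section

open scoped Topology NNReal ENNReal
open Filter Set Metric
open Literature.Probability.LatticeModels (HexVertex hexGraph hexCenter Site)
open Literature.Probability.RandomPlanarGeometry
open Literature.Probability.RandomPlanarGeometry.SAW
open Literature.Probability.Percolation (PathIn)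

namespace Summit.CriticalPhenomena.SAWScalingLimit.Theorems.ObservableToSLE.FloorRatio

/-! ### Canonical walks leave the inner family only next to the boundary -/

section BoundaryExit

open MeasureTheory
open Summit.CriticalPhenomena.SAWScalingLimit.Theorems.ObservableToSLE.Negative
  (eventually_isProbabilityMeasure_hexSAWLaw)

/-- **First exit of a walk**: a walk from a vertex of `R` to a vertex outside `R` has a dart from
`R` to its complement. [folklore] -/
theorem exists_dart_exit {V : Type*} {G : SimpleGraph V} {R : Set V} :
    ∀ {x y : V} (q : G.Walk x y), x ∈ R → y ∉ R → ∃ d ∈ q.darts, d.fst ∈ R ∧ d.snd ∉ R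
  | _, _, SimpleGraph.Walk.nil, hx, hy => (hy hx).elim
  | x, _, SimpleGraph.Walk.cons' _ x₁ _ h q, hx, hy => by
      by_cases hx₁ : x₁ ∈ R
      · obtain ⟨d, hd, h1, h2⟩ := exists_dart_exit q hx₁ hy
        exact ⟨d, List.mem_cons_of_mem _ hd, h1, h2⟩
      · exact ⟨⟨(x, x₁), h⟩, List.mem_cons_self, hx, hx₁⟩

/-- Every vertex of a walk other than its end is the start of one of its darts. [folklore] -/
theorem exists_dart_fst_eq {V : Type*} {G : SimpleGraph V} :
    ∀ {x y : V} (q : G.Walk x y) {z : V}, z ∈ q.support → z ≠ y → ∃ d ∈ q.darts, d.fst = z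
  | _, _, SimpleGraph.Walk.nil, z, hz, hzy => by
      rw [SimpleGraph.Walk.support_nil, List.mem_singleton] at hz
      exact (hzy hz).elim
  | x, _, SimpleGraph.Walk.cons' _ x₁ _ h q, z, hz, hzy => by
      rw [SimpleGraph.Walk.support_cons, List.mem_cons] at hz
      rcases hz with rfl | hz
      · exact ⟨⟨(_, x₁), h⟩, List.mem_cons_self, rfl⟩
      · obtain ⟨d, hd, hdz⟩ := exists_dart_fst_eq q hz hzy
        exact ⟨d, List.mem_cons_of_mem _ hd, hdz⟩

/-- **Canonical walks leave the inner family only next to the boundary.**  At a fixed mesh, let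
`Λ` be the component of `v₀` in the deep vertices of the floor domain `D` (depth `25δ`,
protective floor discs `B(pt i, 12ρ')`) with exact rows in `B(pt i, ρ')`, and let `γ` be a
canonical SAW of `D_δ` from `a` to `b` (floor vertices, `a` and its neighbours in `B(pt 0, ρ')`)
visiting a vertex outside `Λ ∪ {a, b}`.  Then at the FIRST such vertex `v` the walk is within
`25δ` of `∂D ∖ (B(pt 0, 11ρ') ∪ B(pt 1, 11ρ'))`: `v` is not deep (a deep neighbour of `Λ ∪ {a}`
is in `Λ`), it is not a pendant floor vertex (those have one neighbour in `D_δ`, a SAW through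
them would retrace an edge), so its `25δ`-disc contains a point outside `D` and the floor discs,
and the segment to it crosses `∂D`. [folklore] -/
theorem exists_near_frontier_of_exit {D : DobrushinDomain} {δ ρ' : ℝ} {m : ℤ} {Λ : Finset HexVertex}
    {a b v₀ : HexVertex} (hδ : 0 < δ) (hδρ : 25 * δ < ρ')
    (hDh : D.carrier ⊆ {z : ℂ | (D.pt 0).im < z.im})
    (hm1 : ((m : ℝ) - 2 / 3) * (δ * (Real.sqrt 3 / 2)) ≤ (D.pt 0).im)
    (hchar : ∀ z : HexVertex, z ∈ Λ ↔ PathIn hexGraph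
      {u : HexVertex | (δ : ℂ) * hexCenter u ∈ D.carrier ∧ m ≤ u.1 1 ∧
        closedBall ((δ : ℂ) * hexCenter u) (25 * δ) ⊆
          D.carrier ∪ ball (D.pt 0) (12 * ρ') ∪ ball (D.pt 1) (12 * ρ')} v₀ z)
    (hrows : ∀ v : HexVertex, (δ : ℂ) * hexCenter v ∈ ball (D.pt 0) ρ' ∪ ball (D.pt 1) ρ' →
      m ≤ v.1 1 → v ∈ Λ)
    (hBa : ∀ w : HexVertex, (w = a ∨ hexGraph.Adj a w) → (δ : ℂ) * hexCenter w ∈ ball (D.pt 0) ρ')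
    (γ : HexDomainSAW D.carrier δ a b) (hIn : ¬ ∀ v ∈ γ.walk.support, v ∈ Λ ∨ v = a ∨ v = b) :
    ∃ v ∈ γ.walk.support, v ≠ a ∧ v ≠ b ∧ Metric.infDist ((δ : ℂ) * hexCenter v)
      (frontier D.carrier \ (ball (D.pt 0) (11 * ρ') ∪ ball (D.pt 1) (11 * ρ'))) ≤ 25 * δ := by
  push Not at hIn
  obtain ⟨u, hu, huΛ, hua, hub⟩ := hIn
  set R : Set HexVertex := (↑Λ : Set HexVertex) ∪ {a} with hR
  set p := γ.walk.takeUntil u hu with hp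
  obtain ⟨d, hd, hd1, hd2⟩ := exists_dart_exit (R := R) p (Or.inr rfl) fun h =>
    h.elim (fun h => huΛ h) (fun h => hua h)
  have hdγ : d ∈ γ.walk.darts := γ.walk.darts_takeUntil_subset_darts hu hd
  set a' := d.fst with ha'
  set b' := d.snd with hb'
  have hadj : (hexDomainGraph D.carrier δ).Adj a' b' := d.adj
  obtain ⟨hmesh, ha'M, hb'M⟩ := (embDomainGraph_adj_iff _ _).1 hadj
  have hhex : hexGraph.Adj a' b' := ((embMeshGraph_adj_iff _ _).1 hmesh).1
  have ha'D : (δ : ℂ) * hexCenter a' ∈ D.carrier := embMeshDomain_subset _ _ _ _ ha'M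
  have hb'D : (δ : ℂ) * hexCenter b' ∈ D.carrier := embMeshDomain_subset _ _ _ _ hb'M
  have hb'p : b' ∈ p.support := p.dart_snd_mem_support_of_mem_darts hd
  have hb'supp : b' ∈ γ.walk.support := γ.walk.support_takeUntil_subset_support hu hb'p
  have hbp : b ∉ p.support := γ.walk.endpoint_notMem_support_takeUntil γ.isPath hu hub.symm
  have hb'b : b' ≠ b := fun h => hbp (h ▸ hb'p)
  have hb'a : b' ≠ a := fun h => hd2 (Or.inr h)
  have hb'Λ : b' ∉ Λ := fun h => hd2 (Or.inl h)
  -- `b'` is not deep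
  have hnotS : ¬ (m ≤ b'.1 1 ∧ closedBall ((δ : ℂ) * hexCenter b') (25 * δ) ⊆
      D.carrier ∪ ball (D.pt 0) (12 * ρ') ∪ ball (D.pt 1) (12 * ρ')) := by
    rintro ⟨hrow, hball⟩
    rcases hd1 with ha'Λ | ha'a
    · exact hb'Λ ((hchar b').2 (((hchar a').1 ha'Λ).tail hhex ⟨hb'D, hrow, hball⟩))
    · have ha'a : a' = a := ha'a
      exact hb'Λ (hrows b' (Or.inl (hBa b' (Or.inr (ha'a ▸ hhex)))) hrow)
  by_cases hrow : m ≤ b'.1 1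
  · -- the `25δ`-disc pokes out of `D` and of the floor discs
    obtain ⟨y, hy, hyU⟩ := not_subset.1 fun hball => hnotS ⟨hrow, hball⟩
    have hyD : y ∉ D.carrier := fun h => hyU (Or.inl (Or.inl h))
    have hy₀ : y ∉ ball (D.pt 0) (12 * ρ') := fun h => hyU (Or.inl (Or.inr h))
    have hy₁ : y ∉ ball (D.pt 1) (12 * ρ') := fun h => hyU (Or.inr h)
    rw [mem_closedBall] at hy
    obtain ⟨q, hqs, hqfr⟩ := D.toJordanDomain.inter_frontier_nonempty_of_isPreconnected
      (convex_segment ((δ : ℂ) * hexCenter b') y).isPreconnected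
      ⟨_, left_mem_segment ℝ _ _, hb'D⟩ ⟨y, right_mem_segment ℝ _ _, hyD⟩
    have hq1 : dist q ((δ : ℂ) * hexCenter b') ≤ 25 * δ :=
      (mem_closedBall.1 ((convex_closedBall _ _).segment_subset (mem_closedBall_self (by positivity))
        (mem_closedBall.2 hy) hqs))
    have hq2 : dist q y ≤ 25 * δ := by
      have := (convex_closedBall y (25 * δ)).segment_subset (mem_closedBall.2 (by rwa [dist_comm] at hy))
        (mem_closedBall_self (by positivity)) hqs
      exact mem_closedBall.1 this
    have hqF : q ∈ frontier D.carrier \ (ball (D.pt 0) (11 * ρ') ∪ ball (D.pt 1) (11 * ρ')) := by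
      refine ⟨hqfr, ?_⟩
      rintro (h | h)
      · apply hy₀
        rw [mem_ball] at h ⊢
        linarith [dist_triangle y q (D.pt 0), dist_comm y q]
      · apply hy₁
        rw [mem_ball] at h ⊢
        linarith [dist_triangle y q (D.pt 1), dist_comm y q]
    refine ⟨b', hb'supp, hb'a, hb'b, (Metric.infDist_le_dist_of_mem hqF).trans ?_⟩
    rwa [dist_comm]
  · -- a pendant floor vertex: the walk would retrace the edge to its only neighbour
    exfalso
    have hK : 0 < δ * (Real.sqrt 3 / 2) := by positivity
    have him : ∀ v : HexVertex, ((δ : ℂ) * hexCenter v).im =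
        ((v.1 1 : ℝ) + ((v.2 : ℕ) + 1) / 3) * (δ * (Real.sqrt 3 / 2)) := fun v => by
      rw [im_smul_hexCenter]; ring
    push Not at hrow
    have hrow' : (b'.1 1 : ℝ) + 1 ≤ m := by exact_mod_cast hrow
    have hb'im : (D.pt 0).im < ((δ : ℂ) * hexCenter b').im := hDh hb'D
    -- `b' = (x, 1)` with the up-faces of its row on or below the floor
    obtain ⟨x, k⟩ := b'
    have hk : k = 1 := by
      fin_cases k
      · exfalso
        rw [him] at hb'im
        norm_num at hb'im hrow'
        nlinarith
      · rfl
    subst hk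
    have hx0 : ((δ : ℂ) * hexCenter (x, (0 : Fin 2))).im ≤ (D.pt 0).im := by
      rw [him]
      simp only [Fin.val_zero, Nat.cast_zero, zero_add]
      simp only at hrow'
      nlinarith
    -- both walk-neighbours of `b'` are the up-face above it
    have ha'eq : a' = (x + Pi.single 1 1, 0) := floor_pendant_neighbour hδ hx0 hhex.symm (hDh ha'D)
    obtain ⟨d', hd', hd'1⟩ := exists_dart_fst_eq γ.walk hb'supp hb'b
    have hadj' : (hexDomainGraph D.carrier δ).Adj (x, (1 : Fin 2)) d'.snd := hd'1 ▸ d'.adj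
    obtain ⟨hmesh', -, hcM⟩ := (embDomainGraph_adj_iff _ _).1 hadj'
    have hceq : d'.snd = (x + Pi.single 1 1, 0) := floor_pendant_neighbour hδ hx0
      ((embMeshGraph_adj_iff _ _).1 hmesh').1 (hDh (embMeshDomain_subset _ _ _ _ hcM))
    -- the darts `d = (a', b')` and `d' = (b', a')` carry the same edge: contradiction
    have hnd : γ.walk.darts.Nodup := SimpleGraph.Walk.darts_nodup_of_support_nodup γ.isPath.support_nodup
    have hedges : (γ.walk.darts.map SimpleGraph.Dart.edge).Nodup := γ.isPath.isTrail.edges_nodup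
    have hinj := (List.nodup_map_iff_inj_on hnd).1 hedges d hdγ d' hd'
    have hdd' : d = d' := by
      apply hinj
      have e1 : d.fst = d'.snd := by rw [hceq]; exact ha'eq
      have e2 : d.snd = d'.fst := by rw [hd'1]; exact hb'.symm
      show s(d.fst, d.snd) = s(d'.fst, d'.snd)
      rw [e1, e2]
      exact Sym2.eq_swap
    have : a' = (x, (1 : Fin 2)) := by
      show d.fst = (x, 1)
      rw [hdd', hd'1]
    exact hhex.ne this

/-- **Canonical insensitivity from boundary avoidance ((CI) from (BA)).**  For the transparent data
of `discretisation_core` (inner family `Λ` as the component of the bulk vertex, exact floor rows),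
if the canonical critical SAW avoids, with probability `→ 1` as first `δ → 0` then `η → 0`, the
`η`-neighbourhood of `∂D` away from `B(pt 0, 11ρ') ∪ B(pt 1, 11ρ')`, then it stays inside
`Λ δ ∪ {a δ, b δ}` with probability `→ 1`. [folklore] -/
theorem canonicalInsensitivity_of_boundaryAvoidance {D : DobrushinDomain} {ρ' : ℝ}
    {a b : ℝ → HexVertex} {Λ : ℝ → Finset HexVertex} {m : ℝ → ℤ} {v₀ : ℝ → HexVertex}
    (hDh : D.carrier ⊆ {z : ℂ | (D.pt 0).im < z.im})
    (hab : IsEmbEndpointApprox hexGraph hexCenter D a b) (hρ'0 : 0 < ρ')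
    (hm : ∀ δ : ℝ, 0 < δ → ((m δ : ℝ) - 2 / 3) * (δ * (Real.sqrt 3 / 2)) ≤ (D.pt 0).im ∧
      (D.pt 0).im < ((m δ : ℝ) + 1 / 3) * (δ * (Real.sqrt 3 / 2)))
    (hΛ : ∀ᶠ δ : ℝ in 𝓝[>] 0, ∀ z : HexVertex, z ∈ Λ δ ↔ PathIn hexGraph
        {u : HexVertex | (δ : ℂ) * hexCenter u ∈ D.carrier ∧ m δ ≤ u.1 1 ∧
          closedBall ((δ : ℂ) * hexCenter u) (25 * δ) ⊆
            D.carrier ∪ ball (D.pt 0) (12 * ρ') ∪ ball (D.pt 1) (12 * ρ')} (v₀ δ) z)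
    (hrows : ∀ᶠ δ : ℝ in 𝓝[>] 0, ∀ v : HexVertex,
      (δ : ℂ) * hexCenter v ∈ ball (D.pt 0) ρ' ∪ ball (D.pt 1) ρ' → m δ ≤ v.1 1 → v ∈ Λ δ)
    (hBA : ∀ ε : ℝ, 0 < ε → ∃ η : ℝ, 0 < η ∧ ∀ᶠ δ : ℝ in 𝓝[>] 0,
      ((hexSAWLaw D.carrier δ (a δ) (b δ)) {γ | ∃ v ∈ γ.walk.support, v ≠ a δ ∧ v ≠ b δ ∧
        Metric.infDist ((δ : ℂ) * hexCenter v)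
          (frontier D.carrier \ (ball (D.pt 0) (11 * ρ') ∪ ball (D.pt 1) (11 * ρ'))) ≤ η}).toReal ≤ ε) :
    Tendsto (fun δ : ℝ => ((hexSAWLaw D.carrier δ (a δ) (b δ))
      {γ | ∀ v ∈ γ.walk.support, v ∈ Λ δ ∨ v = a δ ∨ v = b δ}).toReal) (𝓝[>] 0) (𝓝 1) := by
  rw [Metric.tendsto_nhds]
  intro ε hε
  obtain ⟨η, hη, hBAη⟩ := hBA (ε / 2) (half_pos hε)
  have hballa := eventually_adj_mem_ball hρ'0 hab.tendsto_fst
  filter_upwards [Ioc_mem_nhdsGT (lt_min (show (0 : ℝ) < η / 25 by positivity)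
    (show (0 : ℝ) < ρ' / 26 by positivity)), hΛ, hrows, hBAη, hballa,
    eventually_isProbabilityMeasure_hexSAWLaw hab] with δ hδ hchar hR hP hBa hprob
  have hδη : 25 * δ ≤ η := by linarith [hδ.2.trans (min_le_left _ _)]
  have hδρ : 25 * δ < ρ' := by linarith [hδ.2.trans (min_le_right _ _)]
  set μ := hexSAWLaw D.carrier δ (a δ) (b δ) with hμ
  set In : Set (HexDomainSAW D.carrier δ (a δ) (b δ)) :=
    {γ | ∀ v ∈ γ.walk.support, v ∈ Λ δ ∨ v = a δ ∨ v = b δ} with hIn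
  set E : Set (HexDomainSAW D.carrier δ (a δ) (b δ)) := {γ | ∃ v ∈ γ.walk.support, v ≠ a δ ∧
    v ≠ b δ ∧ Metric.infDist ((δ : ℂ) * hexCenter v)
      (frontier D.carrier \ (ball (D.pt 0) (11 * ρ') ∪ ball (D.pt 1) (11 * ρ'))) ≤ η} with hE
  have hincl : Inᶜ ⊆ E := fun γ hγ => by
    obtain ⟨v, hv, hva, hvb, hd⟩ := exists_near_frontier_of_exit hδ.1 hδρ hDh (hm δ hδ.1).1 hchar
      hR hBa γ hγ
    exact ⟨v, hv, hva, hvb, hd.trans hδη⟩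
  have h1 : μ In = 1 - μ Inᶜ := by
    rw [prob_compl_eq_one_sub MeasurableSpace.measurableSet_top, ENNReal.sub_sub_cancel
      ENNReal.one_ne_top prob_le_one]
  have h2 : (μ Inᶜ).toReal ≤ ε / 2 :=
    (ENNReal.toReal_mono (measure_ne_top _ _) (measure_mono hincl)).trans hP
  have h3 : (μ In).toReal = 1 - (μ Inᶜ).toReal := by
    rw [h1, ENNReal.toReal_sub_of_le prob_le_one ENNReal.one_ne_top, ENNReal.toReal_one]
  rw [Real.dist_eq, h3, abs_sub_lt_iff]
  constructor <;> linarith [ENNReal.toReal_nonneg (a := μ Inᶜ)]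

end BoundaryExit

/-- **Registered sub-goal `stub_canonicalTransfer_boundaryExit`** (crux item stmt-CriticalPhenomena-10472,
stub `stub_canonicalTransfer`): first exit of a walk from a vertex set, registry form of
`exists_dart_exit` (the walk combinatorics behind the exit lemma). [folklore] -/
theorem stub_canonicalTransfer_boundaryExit :
    ∀ (R : Set HexVertex) (x y : HexVertex) (q : hexGraph.Walk x y), x ∈ R → y ∉ R →
      ∃ d ∈ q.darts, d.fst ∈ R ∧ d.snd ∉ R :=
  fun _ _ _ q hx hy => exists_dart_exit q hx hy

end Summit.CriticalPhenomena.SAWScalingLimit.Theorems.ObservableToSLE.FloorRatio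

end
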